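import Summits.QuantumFields.YangMills.Theorems.SmallFieldWideningLargeFieldMassRefinementTailOfOneRecord
import Summits.QuantumFields.YangMills.Theorems.UnitScaleTiltHistoryTailLaneTailOldRec
import HarnessLib

/-!
# Route `SmallFieldWidening` — crux r3 `LargeFieldMassRefinementTail` (stmt-QuantumFields-22884) CLOSES FROM THE **PLAIN** (α) RECORD AS WELL:
# r3 ⇐ the registered stub 2′ of crux `FluctuationComparisonRegPrL` (stmt-QuantumFields-19935) and ⇐ ONE plain record per odd block size
# (support file, leaf; width seat `ym-line-sfw-p2-w3` gen 15, line `birth`)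

WHY.  The four landed closers of the line take the K2-L programme's χ-currencies: `AvgTailPkg` (w2, `…OfHeightTail`), the record-free interior socket
`AlphaInputsT3AC.IntCoreRec` (`…OfIntCoreRec.largeFieldMassRefinementTail_of_intCoreRec`), ONE χ-record `AlphaInputsT3AC.OfV3ChiAt` per odd `L`
(`…OfOneRecord.largeFieldMassRefinementTail_of_oneChiRecord`) and the shared stub 2′χ `∀ L, Odd L → 1 < L → AlphaInputsT3ACv3RecChi L` of cruxes
stmt-QuantumFields-19936 / 20520 (`…OfIntCoreRec.largeFieldMassRefinementTail_of_laneRecordsChi`).  The K2-L lane ALSO keeps the PLAIN record alive: the ACTIVE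
registered stub 2′ `stub_laneRecordsV3 : ∀ L, Odd L → 1 < L → AlphaInputsT3ACv3Rec L` of crux `FluctuationComparisonRegPrL` (stmt-QuantumFields-19935, the item the
lane `pub-balaban3d` width seats file their helpers under), whose record `AlphaInputsT3AC.OfV3At` carries the (41) core rows and the TOWER-χ lower row (47)′
(`PkgAtV3.le_resDensity_ae`).  The tree's cross-check `HistoryTailLaneTailOldRec.intCoreRec_of_laneRecords` shows that row is already enough for the interior socket
(the interior indicator `𝟙[PlaqSmall (θBal/max(B₃,1))]` sits below the tower's `chiSmall univ θBal` pointwise; no field-window threshold is needed).  Hence, sorry-free: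

* `intCoreBody_of_ofV3At` — ONE plain record `OfV3At F 𝔠 a₀ a₁` instantiates the `IntCoreRec` BODY at its own constants (data cores `(h.pkgAtV3 …).toCore`, constant `a₁`
  by `pkgAtV3_a₁`, interior (47)′ by `HistoryTailLaneTailOldRec.dataIntV3_ineq47AE_of_pkgAtV3`; the binder `θBal ≤ a₁` is idle);
* `largeFieldMassRefinementTail_of_onePlainRecord` — **r3 ⇐ ONE plain record per odd block size `L > 1`, at ANY constants** (`…OfOneRecord.largeFieldMassRefinementTail_of_oneIntCore`);
* `onePlainRecord_of_laneRecords` — 2′ instantiated at its own thresholds gives that one record;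
* `largeFieldMassRefinementTail_of_laneRecords` — **r3 ⇐ 19935's registered stub 2′ BY ITS TEXT**: the closer
  `exact LargeFieldMassRefinementTailOfLaneRecords.largeFieldMassRefinementTail_of_laneRecords ‹2′›` fires the hour 2′ lands, independently of 2′χ.

So the crux is mechanically closable from EITHER of the two registered (α) stubs of the K2-L programme (2′ on 19935, 2′χ on 19936 / 20520), and from the first
single record of either kind the lane exhibits at any one profile.

WHAT THIS IS NOT: no (α) record is constructed here ([Balaban1985UV3] Thms 1–2 at d = 3 — the (41)/(47) cluster-expansion rows — are OPEN hypothesis schemas in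
the tree, never asserted); the crux stays open; nothing here bears on the Yang–Mills mass gap (rung R3 RECORD label only; YM₃ on T³ is not the Clay problem).
-/

set_option autoImplicit false

noncomputable section

open MeasureTheory
open Literature.MathematicalPhysics.QuantumFieldTheory
open Literature.MathematicalPhysics.QuantumFieldTheory.Balaban1983to89
open Literature.MathematicalPhysics.QuantumFieldTheory.Balaban1983to89.T3ContinuumYM3Torus
open Literature.MathematicalPhysics.QuantumFieldTheory.Balaban1983to89.T3UnitScaleTilt (θBal)
open Literature.MathematicalPhysics.QuantumFieldTheory.Balaban1983to89.T3AlphaInputsAC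
open Literature.MathematicalPhysics.QuantumFieldTheory.Balaban1983to89.T3AlphaInputsACSchemas
open Summit.QuantumFields.Balaban3D.Carriers (suGroupModel Hist)
open Summit.QuantumFields.Balaban3D.Proofs.Primitives (AlphaConsts)
open Summit.QuantumFields.YangMills.Theorems
open Summit.QuantumFields.YangMills.Theorems.HistoryTailLaneTailOldRec (dataIntV3_ineq47AE_of_pkgAtV3 intCoreRec_of_laneRecords)
open Summit.QuantumFields.YangMills.Theorems.LargeFieldMassRefinementTailOfIntCoreRec (largeFieldMassRefinementTail_of_intCoreRec)
open Summit.QuantumFields.YangMills.Theorems.LargeFieldMassRefinementTailOfOneRecord (largeFieldMassRefinementTail_of_oneIntCore)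

namespace Summit.QuantumFields.YangMills.Theorems.LargeFieldMassRefinementTailOfLaneRecords

/-- **ONE PLAIN RECORD INSTANTIATES THE `IntCoreRec` BODY AT ITS OWN CONSTANTS** (the record-level content of
`HistoryTailLaneTailOldRec.intCoreRec_of_laneRecords`): from `AlphaInputsT3AC.OfV3At F 𝔠 a₀ a₁` with `0 < a₀`, `0 < a₁`, `𝔠.B₃·a₁ ≤ a₀`, the data cores are
`(h.pkgAtV3 …).toCore`, their constant is `a₁` (`pkgAtV3_a₁`), and the interior (47)′ row is `dataIntV3_ineq47AE_of_pkgAtV3` — unconditionally in the field window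
(the binder `θBal ≤ a₁` is not used). [cite: Balaban1985UV3, (47) p.267 and Thm 2 p.272; Balaban1985Variational, Thm 1 (8) p.279] -/
theorem intCoreBody_of_ofV3At {F : T3Family} {𝔠 : AlphaConsts F.L (suGroupModel 2).N} {a₀ a₁ : ℝ}
    (h : AlphaInputsT3AC.OfV3At F 𝔠 a₀ a₁) (hc : 0 < a₀ ∧ 0 < a₁ ∧ 𝔠.B₃ * a₁ ≤ a₀)
    (γ : ℝ) (hγ : 0 < γ) (hγ1 : γ ≤ (min 𝔠.gamma0 1) ^ 2) :
    ∃ qf : ∀ K, AlphaInputsT3AC.PkgCoreV3 F 𝔠 γ hγ hγ1 K, (∀ K, (qf K).a₁ = a₁) ∧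
      ((∀ i, θBal F.L γ 𝔠.b₀ 𝔠.p₀ i ≤ a₁) →
        ∀ (π : AlphaInputsT3AC.PolymerT3 F) (K j : ℕ), j ≤ K → Ineq47AE (AlphaInputsT3AC.dataIntV3 qf π) K j) :=
  ⟨fun K => (h.pkgAtV3 hc γ hγ hγ1 K).toCore, fun K => h.pkgAtV3_a₁ hc γ hγ hγ1 K,
    fun _ π K j hj => dataIntV3_ineq47AE_of_pkgAtV3 _ π K (h.pkgAtV3 hc γ hγ hγ1 K) rfl j hj⟩

/-- **r3 ⇐ ONE PLAIN RECORD PER ODD BLOCK SIZE `L > 1`, AT ANY CONSTANTS**: if for every odd `L > 1` there are ONE primitive-constants record `𝔠` and constants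
`0 < a₀`, `0 < a₁` with `𝔠.B₃·a₁ ≤ a₀` such that the plain v3 package `AlphaInputsT3AC.OfV3At F 𝔠 a₀ a₁` holds for every three-torus family of block size `L`,
then `LargeFieldMassRefinementTail` holds (`intCoreBody_of_ofV3At`, then `…OfOneRecord.largeFieldMassRefinementTail_of_oneIntCore`: the record's own profile
`p₀ = 2r₀ + 1 > 2` is admissible for r3, which has no tilt-side floor to meet). [cite: Balaban1985UV3, Thm 2 p.272 and (71) p.273; Balaban1985Variational, Thm 1 (8) p.279] -/
theorem largeFieldMassRefinementTail_of_onePlainRecord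
    (hone : ∀ (L : ℕ), Odd L → 1 < L →
      ∃ (𝔠 : AlphaConsts L (suGroupModel 2).N) (a₀ a₁ : ℝ), 0 < a₀ ∧ 0 < a₁ ∧ 𝔠.B₃ * a₁ ≤ a₀ ∧
        ∀ (F : T3Family) (hF : F.L = L), AlphaInputsT3AC.OfV3At F (hF ▸ 𝔠) a₀ a₁) :
    Summit.QuantumFields.YangMills.Theses.SmallFieldWidening.LargeFieldMassRefinementTail := by
  refine largeFieldMassRefinementTail_of_oneIntCore fun L hLo hL => ?_
  obtain ⟨𝔠, a₀, a₁, ha0, ha1, hw, hF⟩ := hone L hLo hL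
  refine ⟨𝔠, a₁, ha1, fun F hFL γ hγ hγ1 => ?_⟩
  subst hFL
  exact intCoreBody_of_ofV3At (hF F rfl) ⟨ha0, ha1, hw⟩ γ hγ hγ1

/-- **2′ ⇒ the one-plain-record hypothesis** (instantiate the record-parametric socket `AlphaInputsT3ACv3Rec L` at its own thresholds `(b₁, p₁)`).
[cite: Balaban1985UV3, (7) p.257 and Thm 2 p.272] -/
theorem onePlainRecord_of_laneRecords
    (hrec : ∀ L : ℕ, Odd L → 1 < L → Summit.QuantumFields.YangMills.Theorems.AlphaInputsT3ACv3Rec L) :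
    ∀ (L : ℕ), Odd L → 1 < L →
      ∃ (𝔠 : AlphaConsts L (suGroupModel 2).N) (a₀ a₁ : ℝ), 0 < a₀ ∧ 0 < a₁ ∧ 𝔠.B₃ * a₁ ≤ a₀ ∧
        ∀ (F : T3Family) (hF : F.L = L), AlphaInputsT3AC.OfV3At F (hF ▸ 𝔠) a₀ a₁ := by
  intro L hLo hL
  obtain ⟨b₁, p₁, h⟩ := hrec L hLo hL
  obtain ⟨𝔠, a₀, a₁, -, -, ha0, ha1, hw, hF⟩ := h b₁ p₁ le_rfl le_rfl
  exact ⟨𝔠, a₀, a₁, ha0, ha1, hw, hF⟩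

/-- **r3 ⇐ THE PLAIN RECORD STUB 2′ OF CRUX `FluctuationComparisonRegPrL` (stmt-QuantumFields-19935)**, by its registered text
`∀ L, Odd L → 1 < L → AlphaInputsT3ACv3Rec L`: `LargeFieldMassRefinementTail` — `largeFieldMassRefinementTail_of_onePlainRecord ∘ onePlainRecord_of_laneRecords`
(equivalently, through the tree's `HistoryTailLaneTailOldRec.intCoreRec_of_laneRecords`:
`largeFieldMassRefinementTail_of_intCoreRec fun L hLo hL => intCoreRec_of_laneRecords L (hrec L hLo hL)` — `largeFieldMassRefinementTail_of_laneRecords'` below).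
The fifth mechanical closing recipe of the crux, independent of the χ-stub 2′χ of stmt-QuantumFields-19936 / 20520.
[cite: Balaban1985UV3, (7) p.257, (47) p.267, Thm 2 p.272 and (71) p.273] -/
theorem largeFieldMassRefinementTail_of_laneRecords
    (hrec : ∀ L : ℕ, Odd L → 1 < L → Summit.QuantumFields.YangMills.Theorems.AlphaInputsT3ACv3Rec L) :
    Summit.QuantumFields.YangMills.Theses.SmallFieldWidening.LargeFieldMassRefinementTail :=
  largeFieldMassRefinementTail_of_onePlainRecord (onePlainRecord_of_laneRecords hrec)

/-- **The same closer through the record-parametric interior socket** (`HistoryTailLaneTailOldRec.intCoreRec_of_laneRecords`, which keeps 2′'s «every profile beyond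
thresholds» uniformity that r3 does not need, then `…OfIntCoreRec.largeFieldMassRefinementTail_of_intCoreRec`) — recorded so that both spellings of the recipe are
kernel-checked against today's tree. [cite: Balaban1985UV3, (7) p.257, (47) p.267 and (71) p.273] -/
theorem largeFieldMassRefinementTail_of_laneRecords'
    (hrec : ∀ L : ℕ, Odd L → 1 < L → Summit.QuantumFields.YangMills.Theorems.AlphaInputsT3ACv3Rec L) :
    Summit.QuantumFields.YangMills.Theses.SmallFieldWidening.LargeFieldMassRefinementTail :=
  largeFieldMassRefinementTail_of_intCoreRec fun L hLo hL => intCoreRec_of_laneRecords L (hrec L hLo hL)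

end Summit.QuantumFields.YangMills.Theorems.LargeFieldMassRefinementTailOfLaneRecords

end
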